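import Summits.HodgeConjecture.HodgeConjecture.Theorems.Ring2AbelianAllWeilLandherrUniqueness
import Summits.HodgeConjecture.HodgeConjecture.Theorems.Ring2AbelianAllWeilSimilarFrames
import Literature.AlgebraicGeometry.Motives.WeilSimilar
import HarnessLib

/-!
# Ring 2 · AbelianAll (ab-weil-1, gen 10, part 8f) — Stage B: two Weil-type carriers of the SAME
  discriminant class are WEIL-SIMILAR (`Motives.IsWeilSimilar`)

research route, not a corollary; conditional on HC_CM plus one named minimal statement.
Cell line: research route conditional on HC_CM; not a corollary; Q11.4-sentence-2 already refuted in dim ≥ 3.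
`HC_CM` (`Theses.RankFourFaces.CMAbelianHodge`) does not occur in this file and no open case of the Hodge
conjecture is claimed.

## What is PROVED here (0 sorry)

van Geemen, Lemma 5.2 (3)–(4) with Thm. 5.3 / Deligne, proof of Thm. 4.8: the complete discrete invariant of a
polarized abelian variety of Weil type `(A, K_d, h_K)` of dimension `2n` is the class
`δ = det Ψ ∈ ℚ^× / Nm(K_d^×)` of its `K_d`-Hermitian form; two members with the same `δ` have ISOMETRIC Hermitian
`K_d`-spaces `(H¹(·, ℚ), H)`.  Part 8c (`exists_gl_conjTranspose_mul_weilGram_mul_eq`) proved the matrix form —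
a congruence `ᵗσ(g) Ψ g = Ψ'` over `K_d`.  This file turns the congruence into the COHOMOLOGICAL statement the
tree's Weil-type ladder consumes:

* §1 `exists_frame_realising_congruent_gram` — **a congruent Gram matrix is realised on the same carrier**: if
  `ᵗσ(g) Ψ g = Ψ'` (`Ψ = a + b√-d` the Gram matrix of a rational `K`-frame `x` of `H¹(A, ℚ)`, `det Ψ' ≠ 0`), then
  the `K`-frame `y_j = Σ_l g_lj · x_l` (`√-d` acting as `φ^*`) is rational, `(y, φ^*y)` is a basis of `H¹(A, ℂ)`,
  and its Gram data are `(a', b')`: `Q_{h_K}(y_i, φ^*y_j) = a'_ij ω`, `Q_{h_K}(y_i, y_j) = b'_ij ω`.  (The twisted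
  forms `H_{±ε} = B(·, φ^*·) ± ε B`, `ε = i√d`, of part 8e carry the computation: `H_ε(y, y) = τ(ᵗσ(g) Ψ g)`.)
* §2 MAIN `isWeilSimilar_of_weilDiscriminantClass_eq` — for `(A, φ)`, `(A', φ')` of Weil type `(n, d)` with Gram
  witnesses of the same class `δ`, `Motives.IsWeilSimilar n A φ h_K A' φ' h'_K`: the `4n`-frames `(y, φ^*y)` of
  `H¹(A)` and `(x', φ'^*x')` of `H¹(A')` have the same rational matrix of `φ^*` (`weilStdEndMatrix n d`) and the
  same rational Gram matrix of `Q_{h_K}` (`weilStdGramMatrix n d a' b'`).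

This is the input "same `δ` ⟹ similar to the anchor" of the tree's print engine
`WeilTypeLadder.weilClassesOf_le_algebraicClasses_of_reachSimilar_of_similarAnchor` (door B of the Weil column):
with it, the per-cell residual N73 `IsogenyConnectedToCMAnchor n d δ` has the ALTERNATIVE residual
"`HodgeTheory.weilFamilyReach_similar` (Deligne's connected PEL family through two similar members, a NAMED print
fact) + charts" — recorded, not re-based (gen 10 GO record, W58′).

What is NOT proved or claimed: N73 on any non-split right-sign cell; any statement about moduli; `HC` for any
abelian variety not already covered in the tree.  No Literature fact is introduced; no internally-minted statement
is cited as a fact.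

## References

* [vanGeemen1994HodgeAV] B. van Geemen, LNM 1594 (1994), Lemma 5.2 (1)–(4), Thm. 5.3.
* [Deligne1982HodgeCycles] P. Deligne, LNM 900 (1982), Lemma 4.6, proof of Thm. 4.8 (p. 48).
* [Landherr1936HermitianForms] W. Landherr, Abh. Math. Sem. Hamburg 11 (1936).
-/

noncomputable section

set_option linter.dupNamespace false

open CategoryTheory Polynomial NumberField
open Literature.AlgebraicGeometry Literature.AlgebraicGeometry.Motives
open Literature.AlgebraicGeometry.HodgeTheory
open Literature.AlgebraicGeometry.VanGeemen1994
open Literature.AlgebraicTopology.SingularHomology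

namespace Summit.HodgeConjecture.HodgeConjecture.Ring2.AbelianAll

/-! ### §0 Two small identities for `Q_{h_K}` -/

/-- `Q_{h_K}(φ^*v, w) = -Q_{h_K}(v, φ^*w)` (from `Q(φ^*v, φ^*w) = d Q(v, w)` and `(φ^*)² = -d`).
[cite: vanGeemen1994HodgeAV, Lemma 5.2 (1)] -/
theorem polarizationPairingOne_ksymm_map_left {A : AbelianVariety ℂ} {φ : A ⟶ A} {d m : ℕ} (hA' : A.dim = m + 1)
    (hd : 0 < d) (hφ : φ ≫ φ = -(d • 𝟙 A)) (e : ProjectiveEmbedding A.X) (a : complexBetti (projectiveSpace e.n ℂ) 2)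
    (v w : complexBetti A.X 1) :
    polarizationPairingOne A.X
        ((d : ℂ) • complexBetti.map e.ι 2 a + complexBetti.map φ.hom.hom.hom 2 (complexBetti.map e.ι 2 a)) m
        (complexBetti.map φ.hom.hom.hom 1 v) w =
      -polarizationPairingOne A.X
        ((d : ℂ) • complexBetti.map e.ι 2 a + complexBetti.map φ.hom.hom.hom 2 (complexBetti.map e.ι 2 a)) m
        v (complexBetti.map φ.hom.hom.hom 1 w) := by
  have hd0 : (d : ℂ) ≠ 0 := Nat.cast_ne_zero.2 hd.ne'
  have h := polarizationPairingOne_map_map_ksymm hA' hd hφ e a v (complexBetti.map φ.hom.hom.hom 1 w)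
  rw [complexBetti_map_map_one_of_comp_self hφ, map_neg, map_smul] at h
  have h2 : (d : ℂ) • (polarizationPairingOne A.X
        ((d : ℂ) • complexBetti.map e.ι 2 a + complexBetti.map φ.hom.hom.hom 2 (complexBetti.map e.ι 2 a)) m
        (complexBetti.map φ.hom.hom.hom 1 v) w +
      polarizationPairingOne A.X
        ((d : ℂ) • complexBetti.map e.ι 2 a + complexBetti.map φ.hom.hom.hom 2 (complexBetti.map e.ι 2 a)) m
        v (complexBetti.map φ.hom.hom.hom 1 w)) = 0 := by
    rw [smul_add, ← h, add_neg_cancel]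
  exact eq_neg_of_add_eq_zero_left ((smul_eq_zero.1 h2).resolve_left hd0)

section SameCarrier

variable {d : ℕ} [Fact (Irreducible (X ^ 2 + C (d : ℚ) : ℚ[X]))] [IsCMField (weilField d)]

/-! ### §1 A congruent Gram matrix is realised on the same carrier -/

/-- **A congruent Gram matrix is realised by a rational `K`-frame of the same carrier.**  Let `x` be a rational
`2n`-frame of `H¹(A, ℚ)` with `(x, φ^*x)` a basis and Gram data `(a, b)` for `Q_{h_K}` relative to `ω`
(`Ψ = a + b√-d`), and let `g ∈ M_{2n}(K_d)`, `g = p + r√-d`, with `ᵗσ(g) Ψ g = Ψ' = a' + b'√-d`, `det Ψ' ≠ 0`.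
Then `y_j = Σ_l (p_lj x_l + r_lj φ^*x_l)` is a rational frame, `(y, φ^*y)` is a basis, and its Gram data are
`(a', b')`. [cite: vanGeemen1994HodgeAV, Lemma 5.2 (1)–(3)] [cite: Deligne1982HodgeCycles, Lemma 4.6] -/
theorem exists_frame_realising_congruent_gram {A : AbelianVariety ℂ} {φ : A ⟶ A} {m k : ℕ} (hd : 0 < d)
    (hA' : A.dim = m + 1) (hφ : φ ≫ φ = -(d • 𝟙 A))
    (e : ProjectiveEmbedding A.X) {a : complexBetti (projectiveSpace e.n ℂ) 2} (haQ : IsRationalClass a)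
    (x : Fin k → complexBetti A.X 1) (ω : complexBetti A.X (2 + 2 * m))
    (am bm : Matrix (Fin k) (Fin k) ℚ) (hx : ∀ i, IsRationalClass (x i))
    (hω : IsRationalClass ω) (hω0 : ω ≠ 0)
    (hQ : ∀ i j, polarizationPairingOne A.X
          ((d : ℂ) • complexBetti.map e.ι 2 a + complexBetti.map φ.hom.hom.hom 2 (complexBetti.map e.ι 2 a)) m
          (x i) (complexBetti.map φ.hom.hom.hom 1 (x j)) = ((am i j : ℚ) : ℂ) • ω ∧
        polarizationPairingOne A.X
          ((d : ℂ) • complexBetti.map e.ι 2 a + complexBetti.map φ.hom.hom.hom 2 (complexBetti.map e.ι 2 a)) m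
          (x i) (x j) = ((bm i j : ℚ) : ℂ) • ω)
    {g : Matrix (Fin k) (Fin k) (weilField d)} {p r : Matrix (Fin k) (Fin k) ℚ}
    (hg : ∀ l j, g l j = algebraMap ℚ (weilField d) (p l j) + algebraMap ℚ (weilField d) (r l j) * weilSqrt d)
    {am' bm' : Matrix (Fin k) (Fin k) ℚ}
    (hcongr : g.transpose.map (IsCMField.complexConj (weilField d)) * weilGramMatrix d am bm * g =
      weilGramMatrix d am' bm')
    (h0' : (weilGramMatrix d am' bm').det ≠ 0) :
    ∃ y : Fin k → complexBetti A.X 1, (∀ i, IsRationalClass (y i)) ∧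
      LinearIndependent ℂ (Sum.elim y (fun i => complexBetti.map φ.hom.hom.hom 1 (y i))) ∧
      ∀ i j, polarizationPairingOne A.X
          ((d : ℂ) • complexBetti.map e.ι 2 a + complexBetti.map φ.hom.hom.hom 2 (complexBetti.map e.ι 2 a)) m
          (y i) (complexBetti.map φ.hom.hom.hom 1 (y j)) = ((am' i j : ℚ) : ℂ) • ω ∧
        polarizationPairingOne A.X
          ((d : ℂ) • complexBetti.map e.ι 2 a + complexBetti.map φ.hom.hom.hom 2 (complexBetti.map e.ι 2 a)) m
          (y i) (y j) = ((bm' i j : ℚ) : ℂ) • ω := by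
  classical
  have hX' : IsSmoothProjective (m + 1) A.X := Motives.isSmoothProjective_of_dim_eq' hA'
  have hd0 : (d : ℂ) ≠ 0 := Nat.cast_ne_zero.2 hd.ne'
  -- notation: `Y = A(ℂ)`, `h_K`, `Q = Q_{h_K}`, `T = φ^*`, `ε = i√d`
  set Y := ComplexPoints A.X with hYdef
  set hK := (d : ℂ) • complexBetti.map e.ι 2 a + complexBetti.map φ.hom.hom.hom 2 (complexBetti.map e.ι 2 a)
    with hKdef
  set Q := polarizationPairingOne A.X hK m with hQdef
  set T := (complexBetti.map φ.hom.hom.hom 1).hom with hTdef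
  set ε : ℂ := Complex.I * (Real.sqrt d : ℂ) with hεdef
  have hε2 : ε * ε = -(d : ℂ) := by rw [← sq, hεdef, I_mul_sqrt_sq]
  have hε2' : (-ε) * (-ε) = -(d : ℂ) := by rw [neg_mul_neg, hε2]
  have hε0 : ε ≠ 0 := by
    intro h
    rw [h, mul_zero] at hε2
    exact hd0 (neg_eq_zero.1 hε2.symm)
  have hsqrt0 : Real.sqrt d ≠ 0 := Real.sqrt_ne_zero'.2 (Nat.cast_pos.2 hd)
  have hT2 : ∀ v, T (T v) = -((d : ℂ) • v) := fun v => complexBetti_map_map_one_of_comp_self hφ v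
  have hQTT : ∀ v w, Q (T v) (T w) = (d : ℂ) • Q v w :=
    fun v w => polarizationPairingOne_map_map_ksymm hA' hd hφ e a v w
  have hQT : ∀ v w, Q (T v) w = -Q v (T w) := fun v w => polarizationPairingOne_ksymm_map_left hA' hd hφ e a v w
  have hQconj : ∀ v w, conjClass Y (2 + 2 * m) (Q v w) = Q (conjClass Y 1 v) (conjClass Y 1 w) :=
    fun v w => conjClass_polarizationPairingOne (isRationalClass_ksymm d φ e haQ) m v w
  -- the coordinate `ℓ` on the line `H^{2m+2}` and the scalar form `B = ℓ ∘ Q`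
  have hline : ∀ c : complexBetti A.X (2 + 2 * m), ∃ s : ℂ, s • ω = c :=
    (finrank_eq_one_iff_of_nonzero' ω hω0).1 (Motives.finrank_complexBetti_two_add_two_mul_eq_one hX')
  obtain ⟨ℓ₀, hℓ₀⟩ := Module.Projective.exists_dual_ne_zero ℂ hω0
  set ℓ : complexBetti A.X (2 + 2 * m) →ₗ[ℂ] ℂ := (ℓ₀ ω)⁻¹ • (ℓ₀ : complexBetti A.X (2 + 2 * m) →ₗ[ℂ] ℂ)
    with hℓdef
  have hℓω : ℓ ω = 1 := by rw [hℓdef, LinearMap.smul_apply, smul_eq_mul, inv_mul_cancel₀ hℓ₀]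
  have hcoord : ∀ c, c = ℓ c • ω := by
    intro c
    obtain ⟨s, rfl⟩ := hline c
    rw [map_smul, smul_eq_mul, hℓω, mul_one]
  set B : complexBetti A.X 1 →ₗ[ℂ] complexBetti A.X 1 →ₗ[ℂ] ℂ := Q.compr₂ ℓ with hBdef
  have hB : ∀ v w, B v w = ℓ (Q v w) := fun v w => rfl
  have hBQ : ∀ v w, Q v w = B v w • ω := fun v w => hcoord _
  have hBa : ∀ i j, B (x i) (T (x j)) = ((am i j : ℚ) : ℂ) := by
    intro i j; rw [hB, (hQ i j).1, map_smul, hℓω, smul_eq_mul, mul_one]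
  have hBb : ∀ i j, B (x i) (x j) = ((bm i j : ℚ) : ℂ) := by
    intro i j; rw [hB, (hQ i j).2, map_smul, hℓω, smul_eq_mul, mul_one]
  have hBTT : ∀ v w, B (T v) (T w) = (d : ℂ) * B v w := by
    intro v w; rw [hB, hQTT, map_smul, smul_eq_mul, hB]
  have hBT : ∀ v w, B (T v) w = -B v (T w) := by intro v w; rw [hB, hQT, map_neg, hB]
  have hBconj : ∀ v w, starRingEnd ℂ (B v w) = B (conjClass Y 1 v) (conjClass Y 1 w) := by
    intro v w
    have h := hQconj v w
    rw [hBQ v w, conjClass_smul, hω.conjClass_eq, hBQ (conjClass Y 1 v)] at h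
    exact smul_left_injective ℂ hω0 h
  have hBreal : ∀ v w, IsRationalClass v → IsRationalClass w → (B v w).im = 0 := by
    intro v w hv hw
    have h := hBconj v w
    rw [hv.conjClass_eq, hw.conjClass_eq] at h
    exact Complex.conj_eq_iff_im.1 h
  -- the twisted forms `H_s = B(·, T·) + s B`, `s = ±ε`, and their values on the frame `x`
  have hHx : ∀ (s : ℂ) (l l' : Fin k), twistedForm B T s (x l) (x l') = ((am l l' : ℚ) : ℂ) + s * ((bm l l' : ℚ) : ℂ) := by
    intro s l l'; rw [twistedForm_apply, hBa, hBb]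
  -- the new `K`-frame `y = g · x`
  set P : Matrix (Fin k) (Fin k) ℂ := fun l j => ((p l j : ℚ) : ℂ) with hPdef
  set R : Matrix (Fin k) (Fin k) ℂ := fun l j => ((r l j : ℚ) : ℂ) with hRdef
  set y : Fin k → complexBetti A.X 1 := fun j => ∑ l, (P l j • x l + R l j • T (x l)) with hydef
  have hyQ : ∀ j, IsRationalClass (y j) := by
    intro j
    refine isRationalClass_sum _ _ fun l _ => ?_
    exact ((hx l).smul (p l j)).add ((isRationalClass_complexBetti_map φ.hom.hom.hom (hx l)).smul (r l j))
  have hTyQ : ∀ j, IsRationalClass (T (y j)) := fun j => isRationalClass_complexBetti_map φ.hom.hom.hom (hyQ j)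
  -- the twisted Gram matrix of `y` under an embedding `τ₀` with `τ₀(√-d) = s`, `s² = -d`: `τ₀(Ψ')`
  have hGram : ∀ τ₀ : weilField d →+* ℂ, τ₀ (weilSqrt d) * τ₀ (weilSqrt d) = -(d : ℂ) →
      (Matrix.of fun i j => twistedForm B T (τ₀ (weilSqrt d)) (y i) (y j)) =
        Matrix.of fun i j => ((am' i j : ℚ) : ℂ) + τ₀ (weilSqrt d) * ((bm' i j : ℚ) : ℂ) := by
    intro τ₀ hs2
    have hl := twistedForm_T_left (B := B) (T := T) hBTT hBT hs2
    have hr := twistedForm_T_right (B := B) (T := T) hT2 hs2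
    have hfc := twistedGram_frame_change (twistedForm B T (τ₀ (weilSqrt d))) T hl hr x P R
    have hxG : (Matrix.of fun l l' => twistedForm B T (τ₀ (weilSqrt d)) (x l) (x l')) =
        Matrix.of fun l l' => ((am l l' : ℚ) : ℂ) + τ₀ (weilSqrt d) * ((bm l l' : ℚ) : ℂ) := by
      ext l l'; rw [Matrix.of_apply, Matrix.of_apply, hHx]
    rw [hxG] at hfc
    rw [show (Matrix.of fun i j => twistedForm B T (τ₀ (weilSqrt d)) (y i) (y j)) =
        Matrix.of fun i j => twistedForm B T (τ₀ (weilSqrt d)) (∑ l, (P l i • x l + R l i • T (x l)))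
          (∑ l, (P l j • x l + R l j • T (x l))) from rfl, hfc]
    exact map_embedding_congr hg hcongr τ₀
  -- the two embeddings `√-d ↦ ±ε`
  obtain ⟨τ, hτ, -⟩ := exists_ringHom_weilField_sqrt d
  set τ' : weilField d →+* ℂ := τ.comp (IsCMField.complexConj (weilField d) : weilField d →+* weilField d)
    with hτ'def
  have hτ' : τ' (weilSqrt d) = -ε := by
    rw [hτ'def, RingHom.comp_apply, RingHom.coe_coe, complexConj_weilSqrt, map_neg, hτ]
  have hG₁ := hGram τ (by rw [hτ]; exact hε2)
  have hG₂ := hGram τ' (by rw [hτ']; exact hε2')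
  rw [hτ] at hG₁
  rw [hτ'] at hG₂
  -- (ii) `(y, Ty)` is linearly independent: both twisted Gram matrices `τ(Ψ')`, `τ'(Ψ')` are non-singular
  have hind : LinearIndependent ℂ (Sum.elim y (fun i => T (y i))) := by
    refine linearIndependent_sum_elim_of_twistedGram_det_ne_zero T (twistedForm B T ε) (twistedForm B T (-ε))
      (twistedForm_T_left hBTT hBT hε2) (twistedForm_T_left hBTT hBT hε2')
      (fun h => hε0 (by linear_combination h / 2)) y ?_ ?_
    · rw [hG₁]
      have h := det_map_embedding_weilGramMatrix_ne_zero τ h0'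
      rwa [hτ] at h
    · rw [hG₂]
      have h := det_map_embedding_weilGramMatrix_ne_zero τ' h0'
      rwa [hτ'] at h
  -- (iii) the Gram data of `y` are `(a', b')`: real parts of `H_ε(y_i, y_j) = a'_ij + ε b'_ij`
  have hByy : ∀ i j, B (y i) (T (y j)) = ((am' i j : ℚ) : ℂ) ∧ B (y i) (y j) = ((bm' i j : ℚ) : ℂ) := by
    intro i j
    have h := congrFun (congrFun hG₁ i) j
    rw [Matrix.of_apply, Matrix.of_apply, twistedForm_apply] at h
    exact eq_and_eq_of_add_mul_eq (hBreal _ _ (hyQ i) (hTyQ j)) (hBreal _ _ (hyQ i) (hyQ j))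
      (Complex.ratCast_im _) (Complex.ratCast_im _) hsqrt0 h
  refine ⟨y, hyQ, hind, fun i j => ⟨?_, ?_⟩⟩
  · rw [hBQ, (hByy i j).1]
  · rw [hBQ, (hByy i j).2]

/-! ### §2 Same discriminant class ⟹ Weil-similar -/

/-- **Two Weil-type carriers of type `(n, d)` with Gram witnesses of the SAME discriminant class are
Weil-similar** (`Motives.IsWeilSimilar n A φ h_K A' φ' h'_K`): by part 8c the Gram matrices are congruent over
`K_d`; §1 realises the congruent Gram matrix `Ψ'` by a rational `K`-frame `y` of `H¹(A)`; the `4n`-frames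
`(y, φ^*y)` and `(x', φ'^*x')` then have the same rational matrix of `φ^*` and the same rational Gram matrix of
`Q_{h_K}` (van Geemen 5.2 (3)–(4) / Deligne's marking condition, Lemma 4.6).
[cite: vanGeemen1994HodgeAV, Lemma 5.2 (3)–(4) and Thm. 5.3] [cite: Deligne1982HodgeCycles, Lemma 4.6 and proof of Thm. 4.8]
[cite: Landherr1936HermitianForms] -/
theorem isWeilSimilar_of_weilDiscriminantClass_eq {A A' : AbelianVariety ℂ} {φ : A ⟶ A} {φ' : A' ⟶ A'}
    {n m : ℕ} (hW : IsWeilType A φ n d) (hW' : IsWeilType A' φ' n d) (hmn : 2 * n = m + 1)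
    (e : ProjectiveEmbedding A.X) {a : complexBetti (projectiveSpace e.n ℂ) 2} (haQ : IsRationalClass a) (ha0 : a ≠ 0)
    (x : Fin (2 * n) → complexBetti A.X 1) (ω : complexBetti A.X (2 + 2 * m))
    (am bm : Matrix (Fin (2 * n)) (Fin (2 * n)) ℚ) (q : ℚˣ) (hx : ∀ i, IsRationalClass (x i))
    (hind : LinearIndependent ℂ (Sum.elim x (fun i => complexBetti.map φ.hom.hom.hom 1 (x i))))
    (hω : IsRationalClass ω) (hω0 : ω ≠ 0)
    (hQ : ∀ i j, polarizationPairingOne A.X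
          ((d : ℂ) • complexBetti.map e.ι 2 a + complexBetti.map φ.hom.hom.hom 2 (complexBetti.map e.ι 2 a)) m
          (x i) (complexBetti.map φ.hom.hom.hom 1 (x j)) = ((am i j : ℚ) : ℂ) • ω ∧
        polarizationPairingOne A.X
          ((d : ℂ) • complexBetti.map e.ι 2 a + complexBetti.map φ.hom.hom.hom 2 (complexBetti.map e.ι 2 a)) m
          (x i) (x j) = ((bm i j : ℚ) : ℂ) • ω)
    (hdet : (weilGramMatrix d am bm).det = algebraMap ℚ (weilField d) (q : ℚ))
    (e' : ProjectiveEmbedding A'.X) {a' : complexBetti (projectiveSpace e'.n ℂ) 2} (ha'Q : IsRationalClass a')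
    (ha'0 : a' ≠ 0)
    (x' : Fin (2 * n) → complexBetti A'.X 1) (ω' : complexBetti A'.X (2 + 2 * m))
    (am' bm' : Matrix (Fin (2 * n)) (Fin (2 * n)) ℚ) (q' : ℚˣ) (hx' : ∀ i, IsRationalClass (x' i))
    (hind' : LinearIndependent ℂ (Sum.elim x' (fun i => complexBetti.map φ'.hom.hom.hom 1 (x' i))))
    (hω' : IsRationalClass ω') (hω'0 : ω' ≠ 0)
    (hQ' : ∀ i j, polarizationPairingOne A'.X
          ((d : ℂ) • complexBetti.map e'.ι 2 a' + complexBetti.map φ'.hom.hom.hom 2 (complexBetti.map e'.ι 2 a')) m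
          (x' i) (complexBetti.map φ'.hom.hom.hom 1 (x' j)) = ((am' i j : ℚ) : ℂ) • ω' ∧
        polarizationPairingOne A'.X
          ((d : ℂ) • complexBetti.map e'.ι 2 a' + complexBetti.map φ'.hom.hom.hom 2 (complexBetti.map e'.ι 2 a')) m
          (x' i) (x' j) = ((bm' i j : ℚ) : ℂ) • ω')
    (hdet' : (weilGramMatrix d am' bm').det = algebraMap ℚ (weilField d) (q' : ℚ))
    (hqq : (QuotientGroup.mk q : weilNormResidueGroup d) = QuotientGroup.mk q') :
    Motives.IsWeilSimilar n A φ
      ((d : ℂ) • complexBetti.map e.ι 2 a + complexBetti.map φ.hom.hom.hom 2 (complexBetti.map e.ι 2 a)) A' φ'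
      ((d : ℂ) • complexBetti.map e'.ι 2 a' + complexBetti.map φ'.hom.hom.hom 2 (complexBetti.map e'.ι 2 a')) := by
  classical
  have hd : 0 < d := hW.d_pos
  have hAm : A.dim = m + 1 := hW.dim_eq.trans hmn
  have hA'm : A'.dim = m + 1 := hW'.dim_eq.trans hmn
  obtain ⟨g, hg⟩ := exists_gl_conjTranspose_mul_weilGram_mul_eq hW hW' hmn e haQ ha0 x ω am bm q hx hind hω hω0
    hQ hdet e' ha'Q ha'0 x' ω' am' bm' q' hx' hind' hω' hω'0 hQ' hdet' hqq
  choose p r hpr using fun l j =>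
    exists_eq_algebraMap_add_mul_weilSqrt d ((g : Matrix (Fin (2 * n)) (Fin (2 * n)) (weilField d)) l j)
  have h0' : (weilGramMatrix d am' bm').det ≠ 0 := by
    rw [hdet']; exact (map_ne_zero (algebraMap ℚ (weilField d))).2 q'.ne_zero
  obtain ⟨y, hyQ, hyind, hyG⟩ := exists_frame_realising_congruent_gram hd hAm hW.sq_eq e haQ x ω am bm hx hω hω0
    hQ hpr hg h0'
  obtain rfl : m = 2 * n - 1 := by omega
  -- the operators and pairings as linear maps
  set T := (complexBetti.map φ.hom.hom.hom 1).hom with hTdef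
  set T' := (complexBetti.map φ'.hom.hom.hom 1).hom with hT'def
  set Q := polarizationPairingOne A.X
    ((d : ℂ) • complexBetti.map e.ι 2 a + complexBetti.map φ.hom.hom.hom 2 (complexBetti.map e.ι 2 a)) (2 * n - 1)
    with hQdef
  set Q' := polarizationPairingOne A'.X
    ((d : ℂ) • complexBetti.map e'.ι 2 a' + complexBetti.map φ'.hom.hom.hom 2 (complexBetti.map e'.ι 2 a'))
    (2 * n - 1) with hQ'def
  have hT2 : ∀ v, T (T v) = -((d : ℂ) • v) := fun v => complexBetti_map_map_one_of_comp_self hW.sq_eq v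
  have hT'2 : ∀ v, T' (T' v) = -((d : ℂ) • v) := fun v => complexBetti_map_map_one_of_comp_self hW'.sq_eq v
  have hQTT : ∀ v w, Q (T v) (T w) = (d : ℂ) • Q v w :=
    fun v w => polarizationPairingOne_map_map_ksymm hAm hd hW.sq_eq e a v w
  have hQ'TT : ∀ v w, Q' (T' v) (T' w) = (d : ℂ) • Q' v w :=
    fun v w => polarizationPairingOne_map_map_ksymm hA'm hd hW'.sq_eq e' a' v w
  have hQT : ∀ v w, Q (T v) w = -Q v (T w) :=
    fun v w => polarizationPairingOne_ksymm_map_left hAm hd hW.sq_eq e a v w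
  have hQ'T : ∀ v w, Q' (T' v) w = -Q' v (T' w) :=
    fun v w => polarizationPairingOne_ksymm_map_left hA'm hd hW'.sq_eq e' a' v w
  refine ⟨fun κ => Sum.elim y (fun i => T (y i)) (finPairEquiv n κ),
    fun κ => Sum.elim x' (fun i => T' (x' i)) (finPairEquiv n κ),
    weilStdEndMatrix n d, weilStdGramMatrix n d am' bm', ω, ω',
    fun κ => pairFrame_forall (P := IsRationalClass) T y hyQ
      (fun i => isRationalClass_complexBetti_map φ.hom.hom.hom (hyQ i)) κ,
    pairFrame_linearIndependent T y hyind,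
    fun κ => pairFrame_forall (P := IsRationalClass) T' x' hx'
      (fun i => isRationalClass_complexBetti_map φ'.hom.hom.hom (hx' i)) κ,
    pairFrame_linearIndependent T' x' hind',
    fun κ => pairFrame_end T hT2 y κ, fun κ => pairFrame_end T' hT'2 x' κ, hω, hω0, hω', hω'0,
    fun κ κ' => pairFrame_gram T Q hQTT hQT y ω am' bm' (fun i j => (hyG i j).1) (fun i j => (hyG i j).2) κ κ',
    fun κ κ' => pairFrame_gram T' Q' hQ'TT hQ'T x' ω' am' bm' (fun i j => (hQ' i j).1) (fun i j => (hQ' i j).2)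
      κ κ'⟩

end SameCarrier

end Summit.HodgeConjecture.HodgeConjecture.Ring2.AbelianAll

end
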